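import Mathlib

/-!
# Route `JensenPolynomials`, FAR crux `XiWindowZeroFreeRelFar` (B1-rel) — the truncated binomial series, II:
geometry of the arc `β ↦ r·e^{iβ}` and the elementary majorants of `J(r, α) = ∫₀^α dβ/‖1 + r e^{iβ}‖`
(RH-FREE; cell rh-jensen, HUMAN RULING D-0040; input of the truncation stub `stub_junk` (S2) of the far-Gumbel skeleton
for item `stmt-RiemannHypothesis-19465`)

Pure geometry/calculus, independent of `T_M`: `‖1 + r e^{iβ}‖² = 1 + r² + 2r cos β = (1−r)² + 4r cos²(β/2)`, its
monotonicity in `β ∈ [0, π]`, `‖1 + re^{iβ}‖ ≥ |1 − r|`, the closed upper half-plane continuity of `z ↦ z^c` at every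
`z ≠ 0` (the principal power at a negative real is the boundary value from above) — which lets the arc END on the cut
`w < −1` — and the two majorants used after the `u`-integration of S2:

* (A) `J(r, α) ≤ α/|1 − r|`;
* (B) `J(r, α) ≤ π/√(|1−r|·√r)` — from Jordan's inequality `cos(β/2) ≥ 1 − β/π` and AM–GM
  `(1−r)² + 4r cos²(β/2) ≥ 4|1−r|√r·cos(β/2)`, with `∫₀^α (√(1−β/π))⁻¹dβ ≤ 2π`; (B) is `|u − u₀|^{−1/2}`-integrable across
  the circle `|w| = 1` (`u₀ = √|σ|`), which (A) is not.

WHAT THIS IS NOT: nothing here bears on the zeros of `ζ` or the truth of RH. References: Jordan's inequality (Mathlib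
`Real.mul_le_sin`); [GORZPNAS2019] for the role of the window EGF.
-/

noncomputable section
-- D-0017: `Summit.RiemannHypothesis.RiemannHypothesis.…` duplicates the namespace BY DESIGN (single-problem summit).
set_option linter.dupNamespace false

namespace Summit.RiemannHypothesis.RiemannHypothesis.Theorems.JensenPolynomials.WindowEGF

open Complex MeasureTheory Set Filter Finset
open scoped Real Topology ComplexConjugate

/-! ## 1. The arc `β ↦ r·e^{iβ}` -/


/-- The arc starts at `r`. -/
theorem arcPt_zero (r : ℝ) : ((r : ℂ) * Complex.exp ((0 : ℂ) * I)) = r := by simp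

/-- `‖r e^{iβ}‖ = r`. -/
theorem norm_arcPt {r : ℝ} (hr : 0 ≤ r) (β : ℝ) : ‖((r : ℂ) * Complex.exp ((β : ℂ) * I))‖ = r := by
  rw [norm_mul, Complex.norm_exp_ofReal_mul_I, mul_one, Complex.norm_real, Real.norm_of_nonneg hr]

/-- `d/dβ (r e^{iβ}) = i·r e^{iβ}`. -/
theorem hasDerivAt_arcPt (r β : ℝ) : HasDerivAt (fun b : ℝ ↦ ((r : ℂ) * Complex.exp ((b : ℂ) * I))) (((r : ℂ) * Complex.exp ((β : ℂ) * I)) * I) β := by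
  have h1 : HasDerivAt (fun b : ℝ ↦ (b : ℂ) * I) (1 * I) β := (hasDerivAt_id β).ofReal_comp.mul_const I
  have h2 : HasDerivAt (fun b : ℝ ↦ Complex.exp ((b : ℂ) * I)) (Complex.exp ((β : ℂ) * I) * (1 * I)) β :=
    h1.cexp
  have h3 := h2.const_mul (r : ℂ)
  have heq : ((r : ℂ) * Complex.exp ((β : ℂ) * I)) * I = (r : ℂ) * (Complex.exp ((β : ℂ) * I) * (1 * I)) := by
    ring
  rw [heq]
  exact h3

/-- The arc is continuous. -/
theorem continuous_arcPt (r : ℝ) : Continuous (fun b : ℝ ↦ ((r : ℂ) * Complex.exp ((b : ℂ) * I))) := by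
  fun_prop

/-- `Im(1 + r e^{iβ}) = r sin β`. -/
theorem one_add_arcPt_im (r β : ℝ) : (1 + ((r : ℂ) * Complex.exp ((β : ℂ) * I))).im = r * Real.sin β := by
  simp [Complex.exp_mul_I, Complex.add_im, Complex.mul_im, Complex.cos_ofReal_im, Complex.sin_ofReal_im,
    Complex.cos_ofReal_re, Complex.sin_ofReal_re]

/-- `Re(1 + r e^{iβ}) = 1 + r cos β`. -/
theorem one_add_arcPt_re (r β : ℝ) : (1 + ((r : ℂ) * Complex.exp ((β : ℂ) * I))).re = 1 + r * Real.cos β := by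
  simp [Complex.exp_mul_I, Complex.add_re, Complex.mul_re, Complex.cos_ofReal_im, Complex.sin_ofReal_im,
    Complex.cos_ofReal_re, Complex.sin_ofReal_re]

/-- `‖1 + r e^{iβ}‖² = 1 + r² + 2r·cos β`. -/
theorem norm_one_add_arcPt_sq (r β : ℝ) : ‖1 + ((r : ℂ) * Complex.exp ((β : ℂ) * I))‖ ^ 2 = 1 + r ^ 2 + 2 * r * Real.cos β := by
  rw [Complex.sq_norm, Complex.normSq_apply, one_add_arcPt_re, one_add_arcPt_im]
  have h := Real.sin_sq_add_cos_sq β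
  nlinarith [h]

/-- Along the arc `|1 + r e^{iβ}|` decreases in `β ∈ [0, π]`. -/
theorem norm_one_add_arcPt_anti {r β α : ℝ} (hr : 0 ≤ r) (h0β : 0 ≤ β) (hβα : β ≤ α) (hαπ : α ≤ π) :
    ‖1 + ((r : ℂ) * Complex.exp ((α : ℂ) * I))‖ ≤ ‖1 + ((r : ℂ) * Complex.exp ((β : ℂ) * I))‖ := by
  have hcos : Real.cos α ≤ Real.cos β :=
    Real.cos_le_cos_of_nonneg_of_le_pi h0β hαπ hβα
  have hsq : ‖1 + ((r : ℂ) * Complex.exp ((α : ℂ) * I))‖ ^ 2 ≤ ‖1 + ((r : ℂ) * Complex.exp ((β : ℂ) * I))‖ ^ 2 := by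
    rw [norm_one_add_arcPt_sq, norm_one_add_arcPt_sq]
    nlinarith
  exact (pow_le_pow_iff_left₀ (norm_nonneg _) (norm_nonneg _) two_ne_zero).mp hsq

/-- `|1 + r e^{iβ}| ≥ |1 − r|`. -/
theorem abs_one_sub_le_norm_one_add_arcPt {r : ℝ} (hr : 0 ≤ r) (β : ℝ) : |1 - r| ≤ ‖1 + ((r : ℂ) * Complex.exp ((β : ℂ) * I))‖ := by
  have h := abs_norm_sub_norm_le (1 : ℂ) (-(((r : ℂ) * Complex.exp ((β : ℂ) * I))))
  rw [norm_neg, norm_arcPt hr, norm_one, sub_neg_eq_add] at h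
  exact h

/-- Points of the upper arc stay in the closed upper half-plane. -/
theorem one_add_arcPt_im_nonneg {r β : ℝ} (hr : 0 ≤ r) (h0 : 0 ≤ β) (hπ : β ≤ π) :
    0 ≤ (1 + ((r : ℂ) * Complex.exp ((β : ℂ) * I))).im := by
  rw [one_add_arcPt_im]
  exact mul_nonneg hr (Real.sin_nonneg_of_nonneg_of_le_pi h0 hπ)

/-- Interior points of the upper arc are off the cut. -/
theorem one_add_arcPt_mem_slitPlane {r β : ℝ} (hr : 0 < r) (h0 : 0 < β) (hπ : β < π) :
    1 + ((r : ℂ) * Complex.exp ((β : ℂ) * I)) ∈ slitPlane := by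
  rw [Complex.mem_slitPlane_iff]
  right
  rw [one_add_arcPt_im]
  exact (mul_pos hr (Real.sin_pos_of_pos_of_lt_pi h0 hπ)).ne'

/-- Continuity of `z ↦ z^c` WITHIN the closed upper half-plane at every `z ≠ 0` (at negative reals the
principal power is the boundary value from above). -/
theorem continuousWithinAt_cpow_const_upper {z : ℂ} (hz : z ≠ 0) (c : ℂ) :
    ContinuousWithinAt (fun x : ℂ ↦ x ^ c) {x : ℂ | 0 ≤ x.im} z := by
  by_cases h : z ∈ slitPlane
  · exact (continuousAt_id.cpow continuousAt_const h).continuousWithinAt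
  · rw [Complex.mem_slitPlane_iff, not_or, not_lt, not_ne_iff] at h
    have him : z.im = 0 := h.2
    have hre : z.re < 0 := by
      rcases h.1.lt_or_eq with hlt | heq
      · exact hlt
      · exfalso; apply hz; exact Complex.ext heq him
    have hlog : ContinuousWithinAt Complex.log {x : ℂ | 0 ≤ x.im} z :=
      Complex.continuousWithinAt_log_of_re_neg_of_im_zero hre him
    have hexp : ContinuousWithinAt (fun x : ℂ ↦ Complex.exp (Complex.log x * c)) {x : ℂ | 0 ≤ x.im} z :=
      (hlog.mul continuousWithinAt_const).cexp
    have hne : ∀ᶠ x in 𝓝[{x : ℂ | 0 ≤ x.im}] z, x ≠ 0 :=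
      (isOpen_ne.eventually_mem hz).filter_mono nhdsWithin_le_nhds
    refine hexp.congr_of_eventuallyEq ?_ (Complex.cpow_def_of_ne_zero hz c)
    filter_upwards [hne] with x hx
    exact Complex.cpow_def_of_ne_zero hx c

/-- Continuity on `[0, α]` (`α ≤ π`) of `β ↦ (1 + r e^{iβ})^c` when the arc avoids `−1`. -/
theorem continuousOn_cpow_one_add_arcPt {r α : ℝ} (hr : 0 ≤ r) (hαπ : α ≤ π)
    (hne : ∀ β ∈ Set.Icc 0 α, 1 + ((r : ℂ) * Complex.exp ((β : ℂ) * I)) ≠ 0) (c : ℂ) :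
    ContinuousOn (fun β : ℝ ↦ (1 + ((r : ℂ) * Complex.exp ((β : ℂ) * I))) ^ c) (Set.Icc 0 α) := by
  intro β hβ
  have hmaps : Set.MapsTo (fun b : ℝ ↦ 1 + ((r : ℂ) * Complex.exp ((b : ℂ) * I))) (Set.Icc 0 α) {x : ℂ | 0 ≤ x.im} := by
    intro b hb
    exact one_add_arcPt_im_nonneg hr hb.1 (hb.2.trans hαπ)
  have hin : ContinuousWithinAt (fun b : ℝ ↦ 1 + ((r : ℂ) * Complex.exp ((b : ℂ) * I))) (Set.Icc 0 α) β :=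
    ((continuous_const.add (continuous_arcPt r)).continuousAt).continuousWithinAt
  have hcomp : ContinuousWithinAt ((fun x : ℂ ↦ x ^ c) ∘ (fun b : ℝ ↦ 1 + ((r : ℂ) * Complex.exp ((b : ℂ) * I)))) (Set.Icc 0 α) β :=
    ContinuousWithinAt.comp (continuousWithinAt_cpow_const_upper (hne β hβ) c) hin hmaps
  exact hcomp

/-! ## 2. The majorants of `J(r, α) = ∫₀^α dβ/‖1 + r e^{iβ}‖` -/

/-- Majorant (A): `J(r, α) ≤ α/|1 − r| ≤ π/|1−r|` (for `r ≠ 1`). -/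
theorem arcInv_integral_le_div (r α : ℝ) (hr : 0 ≤ r) (hr1 : r ≠ 1) (hα0 : 0 ≤ α) :
    ∫ β in (0 : ℝ)..α, ‖1 + ((r : ℂ) * Complex.exp ((β : ℂ) * I))‖⁻¹ ≤ α / |1 - r| := by
  have hd : 0 < |1 - r| := abs_pos.mpr (sub_ne_zero.mpr (Ne.symm hr1))
  have hle : ∀ β ∈ Set.Icc 0 α, ‖1 + ((r : ℂ) * Complex.exp ((β : ℂ) * I))‖⁻¹ ≤ |1 - r|⁻¹ := by
    intro β _
    exact inv_anti₀ hd (abs_one_sub_le_norm_one_add_arcPt hr β)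
  calc ∫ β in (0 : ℝ)..α, ‖1 + ((r : ℂ) * Complex.exp ((β : ℂ) * I))‖⁻¹ ≤ ∫ β in (0 : ℝ)..α, |1 - r|⁻¹ := by
        apply intervalIntegral.integral_mono_on hα0 _ intervalIntegrable_const hle
        -- integrability: bounded by a constant and measurable; use continuity (norm never vanishes)
        apply ContinuousOn.intervalIntegrable
        rw [Set.uIcc_of_le hα0]
        intro β hβ
        have hne : ‖1 + ((r : ℂ) * Complex.exp ((β : ℂ) * I))‖ ≠ 0 := by
          have := abs_one_sub_le_norm_one_add_arcPt hr β
          intro h0; rw [h0] at this; linarith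
        exact (((continuous_const.add (continuous_arcPt r)).norm).continuousAt.inv₀ hne).continuousWithinAt
    _ = α / |1 - r| := by rw [intervalIntegral.integral_const]; simp [div_eq_mul_inv]

/-- Jordan: `cos(β/2) ≥ 1 − β/π` on `[0, π]`. -/
theorem one_sub_div_pi_le_cos_half {β : ℝ} (h0 : 0 ≤ β) (hπ : β ≤ π) : 1 - β / π ≤ Real.cos (β / 2) := by
  have hx0 : 0 ≤ π / 2 - β / 2 := by linarith
  have hx1 : π / 2 - β / 2 ≤ π / 2 := by linarith
  have h := Real.mul_le_sin hx0 hx1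
  rw [Real.sin_pi_div_two_sub] at h
  have hpi : π ≠ 0 := Real.pi_pos.ne'
  have heq : 2 / π * (π / 2 - β / 2) = 1 - β / π := by field_simp
  rw [heq] at h
  exact h

/-- `‖1 + r e^{iβ}‖² = (1 − r)² + 4r cos²(β/2)`. -/
theorem norm_one_add_arcPt_sq' (r β : ℝ) :
    ‖1 + ((r : ℂ) * Complex.exp ((β : ℂ) * I))‖ ^ 2 = (1 - r) ^ 2 + 4 * r * Real.cos (β / 2) ^ 2 := by
  rw [norm_one_add_arcPt_sq, Real.cos_sq (β / 2), show 2 * (β / 2) = β by ring]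
  ring

/-- The lower envelope along the arc: `‖1 + r e^{iβ}‖ ≥ 2√(|1−r|√r)·√(1 − β/π)` on `[0, π]`. -/
theorem sqrt_mul_le_norm_one_add_arcPt {r β : ℝ} (hr : 0 ≤ r) (h0 : 0 ≤ β) (hπ : β ≤ π) :
    2 * Real.sqrt (|1 - r| * Real.sqrt r) * Real.sqrt (1 - β / π) ≤ ‖1 + ((r : ℂ) * Complex.exp ((β : ℂ) * I))‖ := by
  have hcos : 1 - β / π ≤ Real.cos (β / 2) := one_sub_div_pi_le_cos_half h0 hπ
  have h1β : 0 ≤ 1 - β / π := by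
    rw [sub_nonneg, div_le_one Real.pi_pos]; exact hπ
  have hcos0 : 0 ≤ Real.cos (β / 2) := le_trans h1β hcos
  have hsr : Real.sqrt r ^ 2 = r := Real.sq_sqrt hr
  have hsr0 : 0 ≤ Real.sqrt r := Real.sqrt_nonneg r
  -- ‖…‖² ≥ 4 |1-r| √r cos(β/2) ≥ 4 |1-r| √r (1 - β/π)
  have hsq : (2 * Real.sqrt (|1 - r| * Real.sqrt r) * Real.sqrt (1 - β / π)) ^ 2 ≤ ‖1 + ((r : ℂ) * Complex.exp ((β : ℂ) * I))‖ ^ 2 := by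
    rw [norm_one_add_arcPt_sq', mul_pow, mul_pow, Real.sq_sqrt (mul_nonneg (abs_nonneg _) hsr0),
      Real.sq_sqrt h1β]
    have habs : |1 - r| ^ 2 = (1 - r) ^ 2 := sq_abs _
    have hamgm : 2 * |1 - r| * (2 * Real.sqrt r * Real.cos (β / 2)) ≤
        |1 - r| ^ 2 + (2 * Real.sqrt r * Real.cos (β / 2)) ^ 2 := by
      nlinarith [sq_nonneg (|1 - r| - 2 * Real.sqrt r * Real.cos (β / 2))]
    have hmono : |1 - r| * Real.sqrt r * (1 - β / π) ≤ |1 - r| * Real.sqrt r * Real.cos (β / 2) :=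
      mul_le_mul_of_nonneg_left hcos (mul_nonneg (abs_nonneg _) hsr0)
    nlinarith [hamgm, hmono, habs, hsr]
  have hlhs0 : 0 ≤ 2 * Real.sqrt (|1 - r| * Real.sqrt r) * Real.sqrt (1 - β / π) := by positivity
  exact (pow_le_pow_iff_left₀ hlhs0 (norm_nonneg _) two_ne_zero).mp hsq

/-- The antiderivative used for majorant (B): `∫₀^α (√(1−β/π))⁻¹ dβ = 2π(1 − √(1 − α/π)) ≤ 2π` (`0 ≤ α ≤ π`). -/
theorem integral_inv_sqrt_le {α : ℝ} (hα0 : 0 ≤ α) (hαπ : α ≤ π) :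
    IntervalIntegrable (fun β : ℝ ↦ (Real.sqrt (1 - β / π))⁻¹) volume 0 α ∧
      ∫ β in (0 : ℝ)..α, (Real.sqrt (1 - β / π))⁻¹ ≤ 2 * π := by
  set g : ℝ → ℝ := fun β ↦ -2 * π * Real.sqrt (1 - β / π) with hgdef
  have hpi : 0 < π := Real.pi_pos
  have hderiv : ∀ β ∈ Set.Ioo 0 α, HasDerivAt g ((Real.sqrt (1 - β / π))⁻¹) β := by
    intro β hβ
    have hu : 1 - β / π ≠ 0 := by
      have : β / π < 1 := by rw [div_lt_one hpi]; linarith [hβ.2]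
      linarith
    have hupos : 0 < 1 - β / π := by
      have : β / π < 1 := by rw [div_lt_one hpi]; linarith [hβ.2]
      linarith
    have h1 : HasDerivAt (fun b : ℝ ↦ 1 - b / π) (0 - 1 / π) β := by
      have := ((hasDerivAt_id β).div_const π).const_sub 1
      simpa using this
    have h2 : HasDerivAt (fun b : ℝ ↦ Real.sqrt (1 - b / π)) (1 / (2 * Real.sqrt (1 - β / π)) * (0 - 1 / π)) β :=
      (Real.hasDerivAt_sqrt hu).comp β h1
    have h3 := h2.const_mul (-2 * π)
    have heq : -2 * π * (1 / (2 * Real.sqrt (1 - β / π)) * (0 - 1 / π)) = (Real.sqrt (1 - β / π))⁻¹ := by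
      have hs : Real.sqrt (1 - β / π) ≠ 0 := (Real.sqrt_pos.mpr hupos).ne'
      have hpi' : π ≠ 0 := hpi.ne'
      rw [zero_sub, inv_eq_one_div]
      field_simp
    rw [heq] at h3
    exact h3
  have hcont : ContinuousOn g (Set.Icc 0 α) := by
    have : Continuous g := by rw [hgdef]; fun_prop
    exact this.continuousOn
  have hpos : ∀ β ∈ Set.Ioo 0 α, 0 ≤ (Real.sqrt (1 - β / π))⁻¹ := fun β _ ↦ inv_nonneg.mpr (Real.sqrt_nonneg _)
  have hint0 := intervalIntegral.integrableOn_deriv_of_nonneg hcont hderiv hpos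
  have hint : IntervalIntegrable (fun β : ℝ ↦ (Real.sqrt (1 - β / π))⁻¹) volume 0 α :=
    (intervalIntegrable_iff_integrableOn_Ioc_of_le hα0).mpr hint0
  refine ⟨hint, ?_⟩
  rw [intervalIntegral.integral_eq_sub_of_hasDerivAt_of_le hα0 hcont hderiv hint]
  simp only [hgdef]
  have hs0 : 0 ≤ Real.sqrt (1 - α / π) := Real.sqrt_nonneg _
  simp
  nlinarith [hs0, hpi]

/-- Majorant (B): `J(r, α) ≤ π/√(√r·|1 − r|)` for `r > 0`, `r ≠ 1`, `0 ≤ α ≤ π` — integrable in `u` across `r = |σ|/u² = 1`. -/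
theorem arcInv_integral_le_sqrt {r α : ℝ} (hr : 0 < r) (hr1 : r ≠ 1) (hα0 : 0 ≤ α) (hαπ : α ≤ π) :
    ∫ β in (0 : ℝ)..α, ‖1 + ((r : ℂ) * Complex.exp ((β : ℂ) * I))‖⁻¹ ≤ π / Real.sqrt (|1 - r| * Real.sqrt r) := by
  set K : ℝ := 2 * Real.sqrt (|1 - r| * Real.sqrt r) with hKdef
  have habs : 0 < |1 - r| := abs_pos.mpr (sub_ne_zero.mpr (Ne.symm hr1))
  have hK : 0 < K := by
    rw [hKdef]
    have : 0 < |1 - r| * Real.sqrt r := mul_pos habs (Real.sqrt_pos.mpr hr)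
    positivity
  obtain ⟨hint, hval⟩ := integral_inv_sqrt_le hα0 hαπ
  -- pointwise on the open interval
  have hpt : ∀ β ∈ Set.Ioo 0 α, ‖1 + ((r : ℂ) * Complex.exp ((β : ℂ) * I))‖⁻¹ ≤ K⁻¹ * (Real.sqrt (1 - β / π))⁻¹ := by
    intro β hβ
    have hβπ : β < π := lt_of_lt_of_le hβ.2 hαπ
    have hupos : 0 < 1 - β / π := by
      have : β / π < 1 := by rw [div_lt_one Real.pi_pos]; exact hβπ
      linarith
    have hlow := sqrt_mul_le_norm_one_add_arcPt hr.le hβ.1.le hβπ.le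
    have hlow0 : 0 < K * Real.sqrt (1 - β / π) := mul_pos hK (Real.sqrt_pos.mpr hupos)
    rw [← mul_inv]
    exact inv_anti₀ hlow0 hlow
  -- integrability of the left side on [0, α] (continuous, the norm never vanishes)
  have hLint : IntervalIntegrable (fun β : ℝ ↦ ‖1 + ((r : ℂ) * Complex.exp ((β : ℂ) * I))‖⁻¹) volume 0 α := by
    apply ContinuousOn.intervalIntegrable
    intro β _
    have hne : ‖1 + ((r : ℂ) * Complex.exp ((β : ℂ) * I))‖ ≠ 0 := by
      have := abs_one_sub_le_norm_one_add_arcPt hr.le β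
      intro h0; rw [h0] at this; linarith
    exact (((continuous_const.add (continuous_arcPt r)).norm).continuousAt.inv₀ hne).continuousWithinAt
  calc ∫ β in (0 : ℝ)..α, ‖1 + ((r : ℂ) * Complex.exp ((β : ℂ) * I))‖⁻¹
      ≤ ∫ β in (0 : ℝ)..α, K⁻¹ * (Real.sqrt (1 - β / π))⁻¹ :=
        intervalIntegral.integral_mono_on_of_le_Ioo hα0 hLint (hint.const_mul _) hpt
    _ = K⁻¹ * ∫ β in (0 : ℝ)..α, (Real.sqrt (1 - β / π))⁻¹ := intervalIntegral.integral_const_mul _ _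
    _ ≤ K⁻¹ * (2 * π) := by gcongr
    _ = π / Real.sqrt (|1 - r| * Real.sqrt r) := by rw [hKdef]; field_simp

end Summit.RiemannHypothesis.RiemannHypothesis.Theorems.JensenPolynomials.WindowEGF
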